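import Summits.Ventures.WeilGRH.UniformConductorFloorCoprimeData
import HarnessLib

/-!
# GRH arm (rh-explicit, venture WeilGRH): the kernel check of the level-`2` joint cell certificate `certOddDvd2`

Cell `rh-explicit`, WEIL TRACK — GRH ARM (weil-grh-1, gen7 «divisibility floors»).  `JointCert.checkFrame`, `checkOne` and
`checkCells` of the odd pseudo-key certificate `certOddDvd2` at level `m = 2` (`UniformConductorFloorCoprimeData.lean`), by
`decide +kernel`: integer arithmetic only (exact rational slab tables against `(319/320)^(a k)` via `Nat.pow`, the `320` cell
inequalities by the `O(J²)` zipper).  Consumed by `UniformConductorFloorCoprimeFloors.lean`.  No definitions; no named facts;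
standard axioms. [folklore]
-/

namespace Summit.Ventures.WeilGRH

namespace UniformFloor

set_option maxHeartbeats 0 in
set_option maxRecDepth 100000 in
/-- The frame of `certOddDvd2` checks (shape, `φ` bounds, shifts, exact slab masses, exact constant, `e^{2t} ≤ 8`). [folklore] -/
theorem certOddDvd2_checkFrame : certOddDvd2.checkFrame = true := by
  decide +kernel

set_option maxHeartbeats 0 in
set_option maxRecDepth 100000 in
/-- The window of `certOddDvd2` contains `[-1, 1]` (`e · (319/320)^320 ≤ 1`). [folklore] -/
theorem certOddDvd2_checkOne : certOddDvd2.checkOne = true := by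
  decide +kernel

set_option maxHeartbeats 0 in
set_option maxRecDepth 100000 in
/-- All `320` cell inequalities of `certOddDvd2` (the zipper `JointCert.checkCells`). [folklore] -/
theorem certOddDvd2_checkCells : certOddDvd2.checkCells = true := by
  decide +kernel

end UniformFloor

end Summit.Ventures.WeilGRH
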